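import Mathlib
import HarnessLib
import Summits.Ventures.LatticeQCDFlow.Exactness.IMHLevelDecomposition
import Summits.Ventures.LatticeQCDFlow.Scaling.AutoregressiveGaugeAllClosingColdExact

/-!
# LatticeQCDFlow / Scaling — the all-closing conditioner AWAY FROM THE COLD CONFIGURATION: its acceptance at `U` is
# EXACTLY `(Z/∏_ℓ N_ℓ(U))·π{∏N ≤ ∏N(U)} + q{∏N > ∏N(U)}`; proposals with a larger normaliser product are always accepted

HONEST FRAMING: exact (Metropolis-corrected) sampling algorithms for lattice gauge theory;
figures of merit are autocorrelation/cost numbers at stated couplings and volumes; no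
continuum-physics claim.

Venture `LatticeQCDFlow` (cell pub-lqcd), topic `Scaling`, FANOUT row 30 (lean-1, GEN-31) — OUR WORK, the second gauge
instance of `Exactness/IMHLevelDecomposition` (this generation; sibling of `AutoregressiveGaugeHeatBathProfile`).  Setting:
`L ≥ 2`; `w` continuous, `0 < m ≤ w ≤ M`, inversion-symmetric; `(T, C)` a closing assignment; target `π = (F/Z)·Haar^{⊗E}`,
proposal `q = (∏_ℓ F_{C_ℓ}/N_ℓ)·Haar^{⊗E}` with the normalisers `N_ℓ(U) = ∫ ∏_{p ∈ C_ℓ} w((U with ℓ ↦ v)_p) dv`, exact sampler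
`K = indepMH q (∏_ℓ N_ℓ/Z)`: its importance weight is the NORMALISER PRODUCT `∏_ℓ N_ℓ(U)` (how well the plaquettes closed
by each link can be satisfied given the rest of `U`) up to `1/Z`; at the cold configuration it is maximal, `∏_ℓ c_{#C_ℓ}`
(GEN-28).  The level decomposition gives the exact dynamics everywhere:

* **`allClosing_acceptMass_profile`** — `A(U) = (Z/∏_ℓ N_ℓ(U))·π{V : ∏N(V) ≤ ∏N(U)} + q{V : ∏N(V) > ∏N(U)}`.
* **`allClosing_apply_of_larger_normaliser`** — `K(U, S) = q(S)` for measurable `S ⊆ {∏N > ∏N(U)}`: a proposal whose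
  closed plaquettes are better satisfiable than the current one's is ALWAYS accepted.
* **`allClosing_apply_of_smaller_normaliser`** — `K(U, S) = (Z/∏_ℓ N_ℓ(U))·π(S)` for measurable `S ⊆ {∏N ≤ ∏N(U)}`,
  `U ∉ S`.

NOT CLAIMED: multi-step laws from a non-cold start; the distribution of `∏N` under `π` or `q`.
No `def`, no `sorry`, nothing cited as a fact beyond the tree.
-/

noncomputable section

namespace Summit.Ventures.LatticeQCDFlow.Theory2.Autoregressive

open MeasureTheory ProbabilityTheory Function Finset
open scoped ENNReal
open Literature.MathematicalPhysics.QuantumFieldTheory Literature.MathematicalPhysics.QuantumLattice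
open Summit.Ventures.LatticeQCDFlow.Exactness Summit.Ventures.LatticeQCDFlow.Scoring

variable {d L : ℕ} [NeZero L] {G : Type*} [Group G] [TopologicalSpace G] [IsTopologicalGroup G]
  [CompactSpace G] [SecondCountableTopology G] [MeasurableSpace G] [BorelSpace G]

/-- **THE EXACT ACCEPTANCE PROFILE OF THE ALL-CLOSING CONDITIONER**: at every configuration `U`,
`A(U) = (Z/∏_ℓ N_ℓ(U))·π{∏N ≤ ∏N(U)} + q{∏N > ∏N(U)}`. [ours] -/
theorem allClosing_acceptMass_profile (hL : 2 ≤ L) {w : G → ℝ} (hw : Continuous w) {m M : ℝ} (hm0 : 0 < m)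
    (hm : ∀ g, m ≤ w g) (hM : ∀ g, w g ≤ M) (hwinv : ∀ g, w g⁻¹ = w g)
    (T : Finset (Edge d L)) (C : Edge d L → Finset (Plaquette d L))
    (hCne : ∀ ℓ ∈ T, (C ℓ).Nonempty)
    (hCe : ∀ ℓ ∈ T, ∀ p ∈ C ℓ, ℓ ∈ ({(p.1, p.2.1.1), (p.1.shift p.2.1.1, p.2.1.2),
        (p.1.shift p.2.1.2, p.2.1.1), (p.1, p.2.1.2)} : Finset (Edge d L)))
    (hdisj : ∀ ℓ ∈ T, ∀ ℓ' ∈ T, ℓ ≠ ℓ' → Disjoint (C ℓ) (C ℓ'))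
    (hcover : ∀ p : Plaquette d L, ∃ ℓ ∈ T, p ∈ C ℓ)
    (π q : Measure (GaugeConfig d L G)) [IsProbabilityMeasure π] [IsProbabilityMeasure q]
    (hπ : π = (Measure.pi fun _ : Edge d L => haarProbability G).withDensity fun U =>
      ENNReal.ofReal ((∏ p : Plaquette d L, w (plaquetteHolonomy U p.1 p.2.1.1 p.2.1.2)) /
        ∫ V, ∏ p : Plaquette d L, w (plaquetteHolonomy V p.1 p.2.1.1 p.2.1.2) ∂(Measure.pi fun _ : Edge d L => haarProbability G)))
    (hq : q = (Measure.pi fun _ : Edge d L => haarProbability G).withDensity fun U =>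
      ENNReal.ofReal (∏ ℓ ∈ T, (∏ p ∈ C ℓ, w (plaquetteHolonomy U p.1 p.2.1.1 p.2.1.2)) /
          (∫ v, ∏ p ∈ C ℓ, w (plaquetteHolonomy (update U ℓ v) p.1 p.2.1.1 p.2.1.2) ∂(haarProbability G)))) (U : GaugeConfig d L G) :
    (imhAcceptMass q (fun U =>
        (((∫ V, ∏ p : Plaquette d L, w (plaquetteHolonomy V p.1 p.2.1.1 p.2.1.2) ∂(Measure.pi fun _ : Edge d L => haarProbability G)) /
          ∏ ℓ ∈ T, (∫ v, ∏ p ∈ C ℓ, w (plaquetteHolonomy (update U ℓ v) p.1 p.2.1.1 p.2.1.2) ∂(haarProbability G))))⁻¹) U).toReal =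
      ((∫ V, ∏ p : Plaquette d L, w (plaquetteHolonomy V p.1 p.2.1.1 p.2.1.2) ∂(Measure.pi fun _ : Edge d L => haarProbability G)) /
        ∏ ℓ ∈ T, (∫ v, ∏ p ∈ C ℓ, w (plaquetteHolonomy (update U ℓ v) p.1 p.2.1.1 p.2.1.2) ∂(haarProbability G))) *
          π.real {V | ∏ ℓ ∈ T, (∫ v, ∏ p ∈ C ℓ, w (plaquetteHolonomy (update V ℓ v) p.1 p.2.1.1 p.2.1.2) ∂(haarProbability G)) ≤ ∏ ℓ ∈ T, (∫ v, ∏ p ∈ C ℓ, w (plaquetteHolonomy (update U ℓ v) p.1 p.2.1.1 p.2.1.2) ∂(haarProbability G))} +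
        q.real {V | ∏ ℓ ∈ T, (∫ v, ∏ p ∈ C ℓ, w (plaquetteHolonomy (update U ℓ v) p.1 p.2.1.1 p.2.1.2) ∂(haarProbability G)) < ∏ ℓ ∈ T, (∫ v, ∏ p ∈ C ℓ, w (plaquetteHolonomy (update V ℓ v) p.1 p.2.1.1 p.2.1.2) ∂(haarProbability G))} := by
  obtain ⟨-, hρq, -, hρm, hρpos⟩ := allClosing_cold_acceptMass_eq hL hw hm0 hm hM hwinv T C hCne hCe hdisj hcover π q hπ hq
  have hw0 : ∀ g, 0 < w g := fun g => hm0.trans_le (hm g)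
  have hc : 0 < ∫ g, w g ∂(haarProbability G) := haarProbability_integral_pos_of_continuous_pos hw hw0
  have hNlo : ∀ ℓ ∈ T, ∀ V : GaugeConfig d L G, m ^ ((C ℓ).card - 1) * (∫ g, w g ∂(haarProbability G)) ≤
      (∫ v, ∏ p ∈ C ℓ, w (plaquetteHolonomy (update V ℓ v) p.1 p.2.1.1 p.2.1.2) ∂(haarProbability G)) := by
    intro ℓ hℓ V
    obtain ⟨p₀, hp₀⟩ := hCne ℓ hℓ
    exact normaliser_ge hL hw hm0 hm (C ℓ) ℓ hp₀ (hCe ℓ hℓ p₀ hp₀) V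
  have hNPpos : ∀ V : GaugeConfig d L G, 0 < ∏ ℓ ∈ T, (∫ v, ∏ p ∈ C ℓ, w (plaquetteHolonomy (update V ℓ v) p.1 p.2.1.1 p.2.1.2) ∂(haarProbability G)) := fun V =>
    prod_pos fun ℓ hℓ => lt_of_lt_of_le (mul_pos (pow_pos hm0 _) hc) (hNlo ℓ hℓ V)
  have hZTpos : 0 < (∫ V, ∏ p : Plaquette d L, w (plaquetteHolonomy V p.1 p.2.1.1 p.2.1.2) ∂(Measure.pi fun _ : Edge d L => haarProbability G)) :=
    (div_pos_iff_of_pos_right (hNPpos U)).1 (hρpos U)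
  set ρ : GaugeConfig d L G → ℝ := fun U =>
    (∫ V, ∏ p : Plaquette d L, w (plaquetteHolonomy V p.1 p.2.1.1 p.2.1.2) ∂(Measure.pi fun _ : Edge d L => haarProbability G)) /
      ∏ ℓ ∈ T, (∫ v, ∏ p ∈ C ℓ, w (plaquetteHolonomy (update U ℓ v) p.1 p.2.1.1 p.2.1.2) ∂(haarProbability G)) with hρ
  have hwm : Measurable fun U => (ρ U)⁻¹ := hρm.inv
  have hw0' : ∀ U, 0 < (ρ U)⁻¹ := fun U => inv_pos.2 (hρpos U)
  have hρpos' : ∀ V, 0 < ρ V := fun V => hρpos V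
  have hπ' : (q.withDensity fun U => ENNReal.ofReal (ρ U)⁻¹) = π := withDensity_inv_density hρm hρpos hρq
  haveI : IsProbabilityMeasure (q.withDensity fun U => ENNReal.ofReal (ρ U)⁻¹) := by rw [hπ']; infer_instance
  have hiff_le : ∀ V : GaugeConfig d L G, (ρ V)⁻¹ ≤ (ρ U)⁻¹ ↔ ∏ ℓ ∈ T, (∫ v, ∏ p ∈ C ℓ, w (plaquetteHolonomy (update V ℓ v) p.1 p.2.1.1 p.2.1.2) ∂(haarProbability G)) ≤ ∏ ℓ ∈ T, (∫ v, ∏ p ∈ C ℓ, w (plaquetteHolonomy (update U ℓ v) p.1 p.2.1.1 p.2.1.2) ∂(haarProbability G)) := by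
    intro V
    rw [inv_le_inv₀ (hρpos' V) (hρpos' U), hρ]
    show (∫ V, ∏ p : Plaquette d L, w (plaquetteHolonomy V p.1 p.2.1.1 p.2.1.2) ∂(Measure.pi fun _ : Edge d L => haarProbability G)) / ∏ ℓ ∈ T, (∫ v, ∏ p ∈ C ℓ, w (plaquetteHolonomy (update U ℓ v) p.1 p.2.1.1 p.2.1.2) ∂(haarProbability G)) ≤
      (∫ V, ∏ p : Plaquette d L, w (plaquetteHolonomy V p.1 p.2.1.1 p.2.1.2) ∂(Measure.pi fun _ : Edge d L => haarProbability G)) / ∏ ℓ ∈ T, (∫ v, ∏ p ∈ C ℓ, w (plaquetteHolonomy (update V ℓ v) p.1 p.2.1.1 p.2.1.2) ∂(haarProbability G)) ↔ _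
    exact div_le_div_iff_of_pos_left hZTpos (hNPpos U) (hNPpos V)
  have hiff_lt : ∀ V : GaugeConfig d L G, (ρ U)⁻¹ < (ρ V)⁻¹ ↔ ∏ ℓ ∈ T, (∫ v, ∏ p ∈ C ℓ, w (plaquetteHolonomy (update U ℓ v) p.1 p.2.1.1 p.2.1.2) ∂(haarProbability G)) < ∏ ℓ ∈ T, (∫ v, ∏ p ∈ C ℓ, w (plaquetteHolonomy (update V ℓ v) p.1 p.2.1.1 p.2.1.2) ∂(haarProbability G)) := by
    intro V
    rw [← not_le, hiff_le V, not_le]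
  have hlev_le : {V : GaugeConfig d L G | (ρ V)⁻¹ ≤ (ρ U)⁻¹} = {V | ∏ ℓ ∈ T, (∫ v, ∏ p ∈ C ℓ, w (plaquetteHolonomy (update V ℓ v) p.1 p.2.1.1 p.2.1.2) ∂(haarProbability G)) ≤ ∏ ℓ ∈ T, (∫ v, ∏ p ∈ C ℓ, w (plaquetteHolonomy (update U ℓ v) p.1 p.2.1.1 p.2.1.2) ∂(haarProbability G))} :=
    Set.ext fun V => hiff_le V
  have hlev_lt : {V : GaugeConfig d L G | (ρ U)⁻¹ < (ρ V)⁻¹} = {V | ∏ ℓ ∈ T, (∫ v, ∏ p ∈ C ℓ, w (plaquetteHolonomy (update U ℓ v) p.1 p.2.1.1 p.2.1.2) ∂(haarProbability G)) < ∏ ℓ ∈ T, (∫ v, ∏ p ∈ C ℓ, w (plaquetteHolonomy (update V ℓ v) p.1 p.2.1.1 p.2.1.2) ∂(haarProbability G))} :=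
    Set.ext fun V => hiff_lt V
  have hval : ((ρ U)⁻¹)⁻¹ = ((∫ V, ∏ p : Plaquette d L, w (plaquetteHolonomy V p.1 p.2.1.1 p.2.1.2) ∂(Measure.pi fun _ : Edge d L => haarProbability G)) /
        ∏ ℓ ∈ T, (∫ v, ∏ p ∈ C ℓ, w (plaquetteHolonomy (update U ℓ v) p.1 p.2.1.1 p.2.1.2) ∂(haarProbability G))) := by
    rw [inv_inv]
  have h := imhAcceptMass_toReal_level (q := q) hwm hw0' U
  rw [hπ', hlev_le, hlev_lt, hval] at h
  exact h

/-- **A PROPOSAL WITH A LARGER NORMALISER PRODUCT IS ALWAYS ACCEPTED**: `K(U, S) = q(S)` for every measurable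
`S ⊆ {∏N > ∏N(U)}`. [ours] -/
theorem allClosing_apply_of_larger_normaliser (hL : 2 ≤ L) {w : G → ℝ} (hw : Continuous w) {m M : ℝ} (hm0 : 0 < m)
    (hm : ∀ g, m ≤ w g) (hM : ∀ g, w g ≤ M) (hwinv : ∀ g, w g⁻¹ = w g)
    (T : Finset (Edge d L)) (C : Edge d L → Finset (Plaquette d L))
    (hCne : ∀ ℓ ∈ T, (C ℓ).Nonempty)
    (hCe : ∀ ℓ ∈ T, ∀ p ∈ C ℓ, ℓ ∈ ({(p.1, p.2.1.1), (p.1.shift p.2.1.1, p.2.1.2),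
        (p.1.shift p.2.1.2, p.2.1.1), (p.1, p.2.1.2)} : Finset (Edge d L)))
    (hdisj : ∀ ℓ ∈ T, ∀ ℓ' ∈ T, ℓ ≠ ℓ' → Disjoint (C ℓ) (C ℓ'))
    (hcover : ∀ p : Plaquette d L, ∃ ℓ ∈ T, p ∈ C ℓ)
    (π q : Measure (GaugeConfig d L G)) [IsProbabilityMeasure π] [IsProbabilityMeasure q]
    (hπ : π = (Measure.pi fun _ : Edge d L => haarProbability G).withDensity fun U =>
      ENNReal.ofReal ((∏ p : Plaquette d L, w (plaquetteHolonomy U p.1 p.2.1.1 p.2.1.2)) /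
        ∫ V, ∏ p : Plaquette d L, w (plaquetteHolonomy V p.1 p.2.1.1 p.2.1.2) ∂(Measure.pi fun _ : Edge d L => haarProbability G)))
    (hq : q = (Measure.pi fun _ : Edge d L => haarProbability G).withDensity fun U =>
      ENNReal.ofReal (∏ ℓ ∈ T, (∏ p ∈ C ℓ, w (plaquetteHolonomy U p.1 p.2.1.1 p.2.1.2)) /
          (∫ v, ∏ p ∈ C ℓ, w (plaquetteHolonomy (update U ℓ v) p.1 p.2.1.1 p.2.1.2) ∂(haarProbability G)))) (U : GaugeConfig d L G)
    {S : Set (GaugeConfig d L G)} (hS : MeasurableSet S)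
    (hsub : S ⊆ {V | ∏ ℓ ∈ T, (∫ v, ∏ p ∈ C ℓ, w (plaquetteHolonomy (update U ℓ v) p.1 p.2.1.1 p.2.1.2) ∂(haarProbability G)) < ∏ ℓ ∈ T, (∫ v, ∏ p ∈ C ℓ, w (plaquetteHolonomy (update V ℓ v) p.1 p.2.1.1 p.2.1.2) ∂(haarProbability G))}) :
    indepMH q (fun U =>
        (((∫ V, ∏ p : Plaquette d L, w (plaquetteHolonomy V p.1 p.2.1.1 p.2.1.2) ∂(Measure.pi fun _ : Edge d L => haarProbability G)) /
          ∏ ℓ ∈ T, (∫ v, ∏ p ∈ C ℓ, w (plaquetteHolonomy (update U ℓ v) p.1 p.2.1.1 p.2.1.2) ∂(haarProbability G))))⁻¹) U S = q S := by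
  obtain ⟨-, hρq, -, hρm, hρpos⟩ := allClosing_cold_acceptMass_eq hL hw hm0 hm hM hwinv T C hCne hCe hdisj hcover π q hπ hq
  have hw0 : ∀ g, 0 < w g := fun g => hm0.trans_le (hm g)
  have hc : 0 < ∫ g, w g ∂(haarProbability G) := haarProbability_integral_pos_of_continuous_pos hw hw0
  have hNlo : ∀ ℓ ∈ T, ∀ V : GaugeConfig d L G, m ^ ((C ℓ).card - 1) * (∫ g, w g ∂(haarProbability G)) ≤
      (∫ v, ∏ p ∈ C ℓ, w (plaquetteHolonomy (update V ℓ v) p.1 p.2.1.1 p.2.1.2) ∂(haarProbability G)) := by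
    intro ℓ hℓ V
    obtain ⟨p₀, hp₀⟩ := hCne ℓ hℓ
    exact normaliser_ge hL hw hm0 hm (C ℓ) ℓ hp₀ (hCe ℓ hℓ p₀ hp₀) V
  have hNPpos : ∀ V : GaugeConfig d L G, 0 < ∏ ℓ ∈ T, (∫ v, ∏ p ∈ C ℓ, w (plaquetteHolonomy (update V ℓ v) p.1 p.2.1.1 p.2.1.2) ∂(haarProbability G)) := fun V =>
    prod_pos fun ℓ hℓ => lt_of_lt_of_le (mul_pos (pow_pos hm0 _) hc) (hNlo ℓ hℓ V)
  have hZTpos : 0 < (∫ V, ∏ p : Plaquette d L, w (plaquetteHolonomy V p.1 p.2.1.1 p.2.1.2) ∂(Measure.pi fun _ : Edge d L => haarProbability G)) :=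
    (div_pos_iff_of_pos_right (hNPpos U)).1 (hρpos U)
  set ρ : GaugeConfig d L G → ℝ := fun U =>
    (∫ V, ∏ p : Plaquette d L, w (plaquetteHolonomy V p.1 p.2.1.1 p.2.1.2) ∂(Measure.pi fun _ : Edge d L => haarProbability G)) /
      ∏ ℓ ∈ T, (∫ v, ∏ p ∈ C ℓ, w (plaquetteHolonomy (update U ℓ v) p.1 p.2.1.1 p.2.1.2) ∂(haarProbability G)) with hρ
  have hwm : Measurable fun U => (ρ U)⁻¹ := hρm.inv
  have hw0' : ∀ U, 0 < (ρ U)⁻¹ := fun U => inv_pos.2 (hρpos U)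
  have hρpos' : ∀ V, 0 < ρ V := fun V => hρpos V
  have hπ' : (q.withDensity fun U => ENNReal.ofReal (ρ U)⁻¹) = π := withDensity_inv_density hρm hρpos hρq
  haveI : IsProbabilityMeasure (q.withDensity fun U => ENNReal.ofReal (ρ U)⁻¹) := by rw [hπ']; infer_instance
  have hiff_le : ∀ V : GaugeConfig d L G, (ρ V)⁻¹ ≤ (ρ U)⁻¹ ↔ ∏ ℓ ∈ T, (∫ v, ∏ p ∈ C ℓ, w (plaquetteHolonomy (update V ℓ v) p.1 p.2.1.1 p.2.1.2) ∂(haarProbability G)) ≤ ∏ ℓ ∈ T, (∫ v, ∏ p ∈ C ℓ, w (plaquetteHolonomy (update U ℓ v) p.1 p.2.1.1 p.2.1.2) ∂(haarProbability G)) := by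
    intro V
    rw [inv_le_inv₀ (hρpos' V) (hρpos' U), hρ]
    show (∫ V, ∏ p : Plaquette d L, w (plaquetteHolonomy V p.1 p.2.1.1 p.2.1.2) ∂(Measure.pi fun _ : Edge d L => haarProbability G)) / ∏ ℓ ∈ T, (∫ v, ∏ p ∈ C ℓ, w (plaquetteHolonomy (update U ℓ v) p.1 p.2.1.1 p.2.1.2) ∂(haarProbability G)) ≤
      (∫ V, ∏ p : Plaquette d L, w (plaquetteHolonomy V p.1 p.2.1.1 p.2.1.2) ∂(Measure.pi fun _ : Edge d L => haarProbability G)) / ∏ ℓ ∈ T, (∫ v, ∏ p ∈ C ℓ, w (plaquetteHolonomy (update V ℓ v) p.1 p.2.1.1 p.2.1.2) ∂(haarProbability G)) ↔ _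
    exact div_le_div_iff_of_pos_left hZTpos (hNPpos U) (hNPpos V)
  have hiff_lt : ∀ V : GaugeConfig d L G, (ρ U)⁻¹ < (ρ V)⁻¹ ↔ ∏ ℓ ∈ T, (∫ v, ∏ p ∈ C ℓ, w (plaquetteHolonomy (update U ℓ v) p.1 p.2.1.1 p.2.1.2) ∂(haarProbability G)) < ∏ ℓ ∈ T, (∫ v, ∏ p ∈ C ℓ, w (plaquetteHolonomy (update V ℓ v) p.1 p.2.1.1 p.2.1.2) ∂(haarProbability G)) := by
    intro V
    rw [← not_le, hiff_le V, not_le]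
  have hlev_le : {V : GaugeConfig d L G | (ρ V)⁻¹ ≤ (ρ U)⁻¹} = {V | ∏ ℓ ∈ T, (∫ v, ∏ p ∈ C ℓ, w (plaquetteHolonomy (update V ℓ v) p.1 p.2.1.1 p.2.1.2) ∂(haarProbability G)) ≤ ∏ ℓ ∈ T, (∫ v, ∏ p ∈ C ℓ, w (plaquetteHolonomy (update U ℓ v) p.1 p.2.1.1 p.2.1.2) ∂(haarProbability G))} :=
    Set.ext fun V => hiff_le V
  have hlev_lt : {V : GaugeConfig d L G | (ρ U)⁻¹ < (ρ V)⁻¹} = {V | ∏ ℓ ∈ T, (∫ v, ∏ p ∈ C ℓ, w (plaquetteHolonomy (update U ℓ v) p.1 p.2.1.1 p.2.1.2) ∂(haarProbability G)) < ∏ ℓ ∈ T, (∫ v, ∏ p ∈ C ℓ, w (plaquetteHolonomy (update V ℓ v) p.1 p.2.1.1 p.2.1.2) ∂(haarProbability G))} :=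
    Set.ext fun V => hiff_lt V
  have hval : ((ρ U)⁻¹)⁻¹ = ((∫ V, ∏ p : Plaquette d L, w (plaquetteHolonomy V p.1 p.2.1.1 p.2.1.2) ∂(Measure.pi fun _ : Edge d L => haarProbability G)) /
        ∏ ℓ ∈ T, (∫ v, ∏ p ∈ C ℓ, w (plaquetteHolonomy (update U ℓ v) p.1 p.2.1.1 p.2.1.2) ∂(haarProbability G))) := by
    rw [inv_inv]
  have hsub' : S ⊆ {V : GaugeConfig d L G | (ρ U)⁻¹ < (ρ V)⁻¹} := by rw [hlev_lt]; exact hsub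
  exact indepMH_apply_of_subset_upper (q := q) hwm hw0' hS hsub'

/-- **INTO CONFIGURATIONS WITH A SMALLER NORMALISER PRODUCT THE CHAIN MOVES AT THE TARGET'S RATE**:
`K(U, S) = (Z/∏_ℓ N_ℓ(U))·π(S)` for every measurable `S ⊆ {∏N ≤ ∏N(U)}` with `U ∉ S`. [ours] -/
theorem allClosing_apply_of_smaller_normaliser (hL : 2 ≤ L) {w : G → ℝ} (hw : Continuous w) {m M : ℝ} (hm0 : 0 < m)
    (hm : ∀ g, m ≤ w g) (hM : ∀ g, w g ≤ M) (hwinv : ∀ g, w g⁻¹ = w g)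
    (T : Finset (Edge d L)) (C : Edge d L → Finset (Plaquette d L))
    (hCne : ∀ ℓ ∈ T, (C ℓ).Nonempty)
    (hCe : ∀ ℓ ∈ T, ∀ p ∈ C ℓ, ℓ ∈ ({(p.1, p.2.1.1), (p.1.shift p.2.1.1, p.2.1.2),
        (p.1.shift p.2.1.2, p.2.1.1), (p.1, p.2.1.2)} : Finset (Edge d L)))
    (hdisj : ∀ ℓ ∈ T, ∀ ℓ' ∈ T, ℓ ≠ ℓ' → Disjoint (C ℓ) (C ℓ'))
    (hcover : ∀ p : Plaquette d L, ∃ ℓ ∈ T, p ∈ C ℓ)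
    (π q : Measure (GaugeConfig d L G)) [IsProbabilityMeasure π] [IsProbabilityMeasure q]
    (hπ : π = (Measure.pi fun _ : Edge d L => haarProbability G).withDensity fun U =>
      ENNReal.ofReal ((∏ p : Plaquette d L, w (plaquetteHolonomy U p.1 p.2.1.1 p.2.1.2)) /
        ∫ V, ∏ p : Plaquette d L, w (plaquetteHolonomy V p.1 p.2.1.1 p.2.1.2) ∂(Measure.pi fun _ : Edge d L => haarProbability G)))
    (hq : q = (Measure.pi fun _ : Edge d L => haarProbability G).withDensity fun U =>
      ENNReal.ofReal (∏ ℓ ∈ T, (∏ p ∈ C ℓ, w (plaquetteHolonomy U p.1 p.2.1.1 p.2.1.2)) /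
          (∫ v, ∏ p ∈ C ℓ, w (plaquetteHolonomy (update U ℓ v) p.1 p.2.1.1 p.2.1.2) ∂(haarProbability G)))) (U : GaugeConfig d L G)
    {S : Set (GaugeConfig d L G)} (hS : MeasurableSet S)
    (hsub : S ⊆ {V | ∏ ℓ ∈ T, (∫ v, ∏ p ∈ C ℓ, w (plaquetteHolonomy (update V ℓ v) p.1 p.2.1.1 p.2.1.2) ∂(haarProbability G)) ≤ ∏ ℓ ∈ T, (∫ v, ∏ p ∈ C ℓ, w (plaquetteHolonomy (update U ℓ v) p.1 p.2.1.1 p.2.1.2) ∂(haarProbability G))}) (hU : U ∉ S) :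
    (indepMH q (fun U =>
        (((∫ V, ∏ p : Plaquette d L, w (plaquetteHolonomy V p.1 p.2.1.1 p.2.1.2) ∂(Measure.pi fun _ : Edge d L => haarProbability G)) /
          ∏ ℓ ∈ T, (∫ v, ∏ p ∈ C ℓ, w (plaquetteHolonomy (update U ℓ v) p.1 p.2.1.1 p.2.1.2) ∂(haarProbability G))))⁻¹) U).real S =
      ((∫ V, ∏ p : Plaquette d L, w (plaquetteHolonomy V p.1 p.2.1.1 p.2.1.2) ∂(Measure.pi fun _ : Edge d L => haarProbability G)) /
        ∏ ℓ ∈ T, (∫ v, ∏ p ∈ C ℓ, w (plaquetteHolonomy (update U ℓ v) p.1 p.2.1.1 p.2.1.2) ∂(haarProbability G))) * π.real S := by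
  obtain ⟨-, hρq, -, hρm, hρpos⟩ := allClosing_cold_acceptMass_eq hL hw hm0 hm hM hwinv T C hCne hCe hdisj hcover π q hπ hq
  have hw0 : ∀ g, 0 < w g := fun g => hm0.trans_le (hm g)
  have hc : 0 < ∫ g, w g ∂(haarProbability G) := haarProbability_integral_pos_of_continuous_pos hw hw0
  have hNlo : ∀ ℓ ∈ T, ∀ V : GaugeConfig d L G, m ^ ((C ℓ).card - 1) * (∫ g, w g ∂(haarProbability G)) ≤
      (∫ v, ∏ p ∈ C ℓ, w (plaquetteHolonomy (update V ℓ v) p.1 p.2.1.1 p.2.1.2) ∂(haarProbability G)) := by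
    intro ℓ hℓ V
    obtain ⟨p₀, hp₀⟩ := hCne ℓ hℓ
    exact normaliser_ge hL hw hm0 hm (C ℓ) ℓ hp₀ (hCe ℓ hℓ p₀ hp₀) V
  have hNPpos : ∀ V : GaugeConfig d L G, 0 < ∏ ℓ ∈ T, (∫ v, ∏ p ∈ C ℓ, w (plaquetteHolonomy (update V ℓ v) p.1 p.2.1.1 p.2.1.2) ∂(haarProbability G)) := fun V =>
    prod_pos fun ℓ hℓ => lt_of_lt_of_le (mul_pos (pow_pos hm0 _) hc) (hNlo ℓ hℓ V)
  have hZTpos : 0 < (∫ V, ∏ p : Plaquette d L, w (plaquetteHolonomy V p.1 p.2.1.1 p.2.1.2) ∂(Measure.pi fun _ : Edge d L => haarProbability G)) :=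
    (div_pos_iff_of_pos_right (hNPpos U)).1 (hρpos U)
  set ρ : GaugeConfig d L G → ℝ := fun U =>
    (∫ V, ∏ p : Plaquette d L, w (plaquetteHolonomy V p.1 p.2.1.1 p.2.1.2) ∂(Measure.pi fun _ : Edge d L => haarProbability G)) /
      ∏ ℓ ∈ T, (∫ v, ∏ p ∈ C ℓ, w (plaquetteHolonomy (update U ℓ v) p.1 p.2.1.1 p.2.1.2) ∂(haarProbability G)) with hρ
  have hwm : Measurable fun U => (ρ U)⁻¹ := hρm.inv
  have hw0' : ∀ U, 0 < (ρ U)⁻¹ := fun U => inv_pos.2 (hρpos U)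
  have hρpos' : ∀ V, 0 < ρ V := fun V => hρpos V
  have hπ' : (q.withDensity fun U => ENNReal.ofReal (ρ U)⁻¹) = π := withDensity_inv_density hρm hρpos hρq
  haveI : IsProbabilityMeasure (q.withDensity fun U => ENNReal.ofReal (ρ U)⁻¹) := by rw [hπ']; infer_instance
  have hiff_le : ∀ V : GaugeConfig d L G, (ρ V)⁻¹ ≤ (ρ U)⁻¹ ↔ ∏ ℓ ∈ T, (∫ v, ∏ p ∈ C ℓ, w (plaquetteHolonomy (update V ℓ v) p.1 p.2.1.1 p.2.1.2) ∂(haarProbability G)) ≤ ∏ ℓ ∈ T, (∫ v, ∏ p ∈ C ℓ, w (plaquetteHolonomy (update U ℓ v) p.1 p.2.1.1 p.2.1.2) ∂(haarProbability G)) := by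
    intro V
    rw [inv_le_inv₀ (hρpos' V) (hρpos' U), hρ]
    show (∫ V, ∏ p : Plaquette d L, w (plaquetteHolonomy V p.1 p.2.1.1 p.2.1.2) ∂(Measure.pi fun _ : Edge d L => haarProbability G)) / ∏ ℓ ∈ T, (∫ v, ∏ p ∈ C ℓ, w (plaquetteHolonomy (update U ℓ v) p.1 p.2.1.1 p.2.1.2) ∂(haarProbability G)) ≤
      (∫ V, ∏ p : Plaquette d L, w (plaquetteHolonomy V p.1 p.2.1.1 p.2.1.2) ∂(Measure.pi fun _ : Edge d L => haarProbability G)) / ∏ ℓ ∈ T, (∫ v, ∏ p ∈ C ℓ, w (plaquetteHolonomy (update V ℓ v) p.1 p.2.1.1 p.2.1.2) ∂(haarProbability G)) ↔ _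
    exact div_le_div_iff_of_pos_left hZTpos (hNPpos U) (hNPpos V)
  have hiff_lt : ∀ V : GaugeConfig d L G, (ρ U)⁻¹ < (ρ V)⁻¹ ↔ ∏ ℓ ∈ T, (∫ v, ∏ p ∈ C ℓ, w (plaquetteHolonomy (update U ℓ v) p.1 p.2.1.1 p.2.1.2) ∂(haarProbability G)) < ∏ ℓ ∈ T, (∫ v, ∏ p ∈ C ℓ, w (plaquetteHolonomy (update V ℓ v) p.1 p.2.1.1 p.2.1.2) ∂(haarProbability G)) := by
    intro V
    rw [← not_le, hiff_le V, not_le]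
  have hlev_le : {V : GaugeConfig d L G | (ρ V)⁻¹ ≤ (ρ U)⁻¹} = {V | ∏ ℓ ∈ T, (∫ v, ∏ p ∈ C ℓ, w (plaquetteHolonomy (update V ℓ v) p.1 p.2.1.1 p.2.1.2) ∂(haarProbability G)) ≤ ∏ ℓ ∈ T, (∫ v, ∏ p ∈ C ℓ, w (plaquetteHolonomy (update U ℓ v) p.1 p.2.1.1 p.2.1.2) ∂(haarProbability G))} :=
    Set.ext fun V => hiff_le V
  have hlev_lt : {V : GaugeConfig d L G | (ρ U)⁻¹ < (ρ V)⁻¹} = {V | ∏ ℓ ∈ T, (∫ v, ∏ p ∈ C ℓ, w (plaquetteHolonomy (update U ℓ v) p.1 p.2.1.1 p.2.1.2) ∂(haarProbability G)) < ∏ ℓ ∈ T, (∫ v, ∏ p ∈ C ℓ, w (plaquetteHolonomy (update V ℓ v) p.1 p.2.1.1 p.2.1.2) ∂(haarProbability G))} :=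
    Set.ext fun V => hiff_lt V
  have hval : ((ρ U)⁻¹)⁻¹ = ((∫ V, ∏ p : Plaquette d L, w (plaquetteHolonomy V p.1 p.2.1.1 p.2.1.2) ∂(Measure.pi fun _ : Edge d L => haarProbability G)) /
        ∏ ℓ ∈ T, (∫ v, ∏ p ∈ C ℓ, w (plaquetteHolonomy (update U ℓ v) p.1 p.2.1.1 p.2.1.2) ∂(haarProbability G))) := by
    rw [inv_inv]
  have hsub' : S ⊆ {V : GaugeConfig d L G | (ρ V)⁻¹ ≤ (ρ U)⁻¹} := by rw [hlev_le]; exact hsub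
  have h := indepMH_apply_of_subset_lower (q := q) hwm hw0' hS hsub' hU
  rw [hπ'] at h
  rw [Measure.real, h, ENNReal.toReal_mul, ← hval, ENNReal.toReal_ofReal (inv_nonneg.2 (hw0' U).le), Measure.real]

end Summit.Ventures.LatticeQCDFlow.Theory2.Autoregressive

end
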